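import Mathlib
import Summits.Ventures.HodgeRepro2.T5InertSphericalSubquotient
import Summits.Ventures.HodgeRepro2.T5InertSphericalEigenvalueCompletion

/-!
# `π_{χ_λ}` IS THE SPHERICAL SUBQUOTIENT OF `I(α N(v)⁻²)` ON THE RECORD'S LOCAL FIELDS

Tier-5 support N3 / §G-N4.2 (seat p3, gen 85). File 337 proved, on the abstract inert-place package, that the
irreducible `K`-spherical representation `π_{χ_λ}` with `T₁`-eigenvalue `λ = q²(α + α⁻¹) + (q − 1)` is the
spherical subquotient of the unramified principal series `I(α q⁻²)`. On Mathlib's completions `K_v ⊆ L_w` of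
the record's number fields at an inert place (`e(w/v) = 1`, `[L_w : K_v] = 2`, `σ ≠ 1`, a uniformiser `ϖ` of
`K_v` staying irreducible in `𝒪_{L_w}`) the two inert-place hypotheses are theorems (files 204 / 206 / 214) and
`q = N(v)` (file 207), so:

* **`nonempty_equiv_inertSphericalQuot_quotRep_adicCompletion`** — for `χ(T₁) = N(v)²(α + α⁻¹) + (N(v) − 1)`,
  `π_χ ≅ inertSphericalQuot (α N(v)⁻²)` on `U(J₃(u))(L_w)`;
* **`exists_param_nonempty_equiv_inertSphericalQuot_quotRep_adicCompletion`** — for every `λ` some `α ≠ 0` has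
  `λ = N(v)²(α + α⁻¹) + (N(v) − 1)` and realises `π_{χ_λ}` as the spherical subquotient of `I(α N(v)⁻²)`;
* **`nonempty_equiv_inertSphericalQuot_quotRep_toy`** — the numeral on seat p4's place `ℚ(ζ₃)/ℚ` at `2`
  (`N(v) = 2`): `χ(T₁) = 4(α + α⁻¹) + 1` gives `π_χ ≅ inertSphericalQuot (α / 4)`.

This is the transport of rows 12–14's «principal-series identification» to the record's pair (the item
«rows 12–14 transport (cosmetic)» of the still-print list), with the subquotient statement of file 337.

Nothing here is a statement about (P), theta lifts or L-values. §8(d): uses an L-value-free non-vanishing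
device: NO.
-/

open IsDedekindDomain HeightOneSpectrum NumberField
open Summit.Ventures.HodgeRepro2.T5HermitianThreeElements Summit.Ventures.HodgeRepro2.T5UnitaryGroupForm
  Summit.Ventures.HodgeRepro2.T5UnitaryHeckeAdjoint Summit.Ventures.HodgeRepro2.T5HeckeBasisCells
  Summit.Ventures.HodgeRepro2.T5HeckePermutationModule Summit.Ventures.HodgeRepro2.T5HeckeDoubleCoset
  Summit.Ventures.HodgeRepro2.T5GaloisCartanThree Summit.Ventures.HodgeRepro2.T5InertUnipotentResidue
  Summit.Ventures.HodgeRepro2.T5InertDegreeGalois Summit.Ventures.HodgeRepro2.T5InertPlaceCompletion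
  Summit.Ventures.HodgeRepro2.T5InertDegreeAdicCompletion Summit.Ventures.HodgeRepro2.T5InertPrincipalSeries
  Summit.Ventures.HodgeRepro2.T5InertSatakeTransformCompletion Summit.Ventures.HodgeRepro2.T5InertIwasawa
  Summit.Ventures.HodgeRepro2.T5InertSphericalClassification Summit.Ventures.HodgeRepro2.T5InertSphericalVector
  Summit.Ventures.HodgeRepro2.T5InertSphericalSubquotient Summit.Ventures.HodgeRepro2.T5HeckeInducedIrreducible
  Summit.Ventures.HodgeRepro2.T5HeckeCharacterRepresentation Summit.Ventures.HodgeRepro2.T5InertHeckeCharacter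

namespace Summit.Ventures.HodgeRepro2.T5InertSphericalSubquotientCompletion

section Abstract

variable {R E : Type*} [CommRing R] [Field E] [StarRing E] [Algebra R E] [IsFractionRing R E] [IsDomain R]
  [IsDiscreteValuationRing R] [Finite (IsLocalRing.ResidueField R)]
  (hstar : ∀ x : E, IsLocalization.IsInteger R x → IsLocalization.IsInteger R (star x))
  (u : E) (hsu : star u = u) (hu0 : u ≠ 0) (hu : IsLocalization.IsInteger R u)
  (hu' : IsLocalization.IsInteger R u⁻¹) {ϖ : R} (hϖ : Irreducible ϖ)
  (hs : star (algebraMap R E ϖ) = algebraMap R E ϖ) (k : Type*) [Field k] [CharZero k] [IsAlgClosed k]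
  (he : ∃ e : R, algebraMap R E e + star (algebraMap R E e) = 1)
  (hnt : ∃ t, T5InertResidueInvolution.residueStar hstar hϖ hs t ≠ t)

include he hnt in
/-- File 337's identification with the parameter `c = α q⁻²` and the eigenvalue `λ = q²(α + α⁻¹) + (q − 1)` given
as any expressions EQUAL to them (the form that transports to the completions, where `q = N(v)`, and to the
numeral places): for `χ(T₁) = λ`, `π_χ ≅ inertSphericalQuot c`. -/
theorem nonempty_equiv_inertSphericalQuot_quotRep_of_eq {α : k} (hα : α ≠ 0) (c : k)
    (hc : c = α * ((Nat.card (traceZero R E) : k) ^ 2)⁻¹) (lam : k)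
    (hlam : lam = (Nat.card (traceZero R E) : k) ^ 2 * (α + α⁻¹) + ((Nat.card (traceZero R E) : k) - 1))
    (χ : heckeAlgebra k (hyperspecialSubgroup R (J3 u)) →ₐ[k] k)
    (hχ : χ (heckeBasisCells hstar u hsu hu0 hu hu' hϖ hs k 1) = lam) :
    letI := charModule k (hyperspecialSubgroup R (J3 u)) χ
    letI := charScalarTower k (hyperspecialSubgroup R (J3 u)) χ
    Nonempty ((inertSphericalQuot hstar u hsu hu0 hu hu' hϖ hs k c).Equiv
      (quotRep k (hyperspecialSubgroup R (J3 u)) k (fun _ => inferInstance))) := by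
  subst hc hlam
  exact nonempty_equiv_inertSphericalQuot_quotRep hstar u hsu hu0 hu hu' hϖ hs k he hnt hα χ hχ

end Abstract

section Completion

variable {K : Type*} [Field K] [NumberField K] (v : HeightOneSpectrum (RingOfIntegers K))
  {L : Type*} [Field L] [NumberField L] [Algebra K L] (w : HeightOneSpectrum (RingOfIntegers L))
  [w.asIdeal.LiesOver v.asIdeal]
  [IsDiscreteValuationRing (integralClosure (v.adicCompletionIntegers K) (w.adicCompletion L))]
  [Finite (IsLocalRing.ResidueField (integralClosure (v.adicCompletionIntegers K) (w.adicCompletion L)))]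
  [IsFractionRing (integralClosure (v.adicCompletionIntegers K) (w.adicCompletion L)) (w.adicCompletion L)]
  [StarRing (w.adicCompletion L)]
  (σ : (w.adicCompletion L) ≃ₐ[v.adicCompletion K] (w.adicCompletion L))
  (hst : ∀ x : w.adicCompletion L, star x = σ x)
  (he : v.asIdeal.ramificationIdx' w.asIdeal = 1)
  (h2 : Module.finrank (v.adicCompletion K) (w.adicCompletion L) = 2) (hσ : σ ≠ 1)
  {ϖ : v.adicCompletionIntegers K} (hϖ : Irreducible ϖ)
  (hinert : Irreducible (algebraMap (v.adicCompletionIntegers K) (w.adicCompletionIntegers L) ϖ))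
  (u : (v.adicCompletionIntegers K)ˣ) (k : Type*) [Field k] [CharZero k] [IsAlgClosed k]

omit [IsAlgClosed k] in
/-- `N(v) ≠ 0` in `k` (characteristic `0`; `v.asIdeal ≠ ⊥`). -/
theorem absNorm_natCast_ne_zero : ((Ideal.absNorm v.asIdeal : ℕ) : k) ≠ 0 :=
  Nat.cast_ne_zero.mpr (fun h => v.ne_bot (Ideal.absNorm_eq_zero_iff.mp h))

include hst he h2 hσ hϖ hinert in
/-- **`π_χ` IS THE SPHERICAL SUBQUOTIENT OF `I(α N(v)⁻²)` ON THE RECORD'S LOCAL FIELDS**: for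
`χ(T₁) = N(v)²(α + α⁻¹) + (N(v) − 1)`, `π_χ ≅ inertSphericalQuot (α N(v)⁻²)` (file 337 with `q = N(v)`). -/
theorem nonempty_equiv_inertSphericalQuot_quotRep_adicCompletion {α : k} (hα : α ≠ 0)
    (χ : heckeAlgebra k (hyperspecialSubgroup (integralClosure (v.adicCompletionIntegers K) (w.adicCompletion L))
      (J3 (algebraMap (v.adicCompletionIntegers K) (w.adicCompletion L) (u : v.adicCompletionIntegers K)))) →ₐ[k] k)
    (hχ : χ (heckeBasisCells (hstar_of_star_eq σ hst)
        (algebraMap (v.adicCompletionIntegers K) (w.adicCompletion L) (u : v.adicCompletionIntegers K))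
        (star_algebraMap_of_star_eq σ hst (u : v.adicCompletionIntegers K))
        (algebraMap_unit_ne_zero (F := v.adicCompletion K) u) (isInteger_algebraMap (u : v.adicCompletionIntegers K))
        (isInteger_algebraMap_unit_inv u)
        (irreducible_uniformiser (map_maximalIdeal_integralClosure_eq_of_irreducible v w hϖ hinert) hϖ)
        (star_algebraMap_of_star_eq σ hst ϖ) k 1) =
      (Ideal.absNorm v.asIdeal : k) ^ 2 * (α + α⁻¹) + ((Ideal.absNorm v.asIdeal : k) - 1)) :
    letI := charModule k (hyperspecialSubgroup (integralClosure (v.adicCompletionIntegers K) (w.adicCompletion L))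
      (J3 (algebraMap (v.adicCompletionIntegers K) (w.adicCompletion L) (u : v.adicCompletionIntegers K)))) χ
    letI := charScalarTower k
      (hyperspecialSubgroup (integralClosure (v.adicCompletionIntegers K) (w.adicCompletion L))
        (J3 (algebraMap (v.adicCompletionIntegers K) (w.adicCompletion L) (u : v.adicCompletionIntegers K)))) χ
    Nonempty ((inertSphericalQuot (hstar_of_star_eq σ hst)
      (algebraMap (v.adicCompletionIntegers K) (w.adicCompletion L) (u : v.adicCompletionIntegers K))
      (star_algebraMap_of_star_eq σ hst (u : v.adicCompletionIntegers K))
      (algebraMap_unit_ne_zero (F := v.adicCompletion K) u) (isInteger_algebraMap (u : v.adicCompletionIntegers K))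
      (isInteger_algebraMap_unit_inv u)
      (irreducible_uniformiser (map_maximalIdeal_integralClosure_eq_of_irreducible v w hϖ hinert) hϖ)
      (star_algebraMap_of_star_eq σ hst ϖ) k (α * ((Ideal.absNorm v.asIdeal : k) ^ 2)⁻¹)).Equiv
        (quotRep k (hyperspecialSubgroup (integralClosure (v.adicCompletionIntegers K) (w.adicCompletion L))
          (J3 (algebraMap (v.adicCompletionIntegers K) (w.adicCompletion L) (u : v.adicCompletionIntegers K)))) k
          (fun _ => inferInstance))) := by
  exact nonempty_equiv_inertSphericalQuot_quotRep_of_eq (hstar_of_star_eq σ hst)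
    (algebraMap (v.adicCompletionIntegers K) (w.adicCompletion L) (u : v.adicCompletionIntegers K))
    (star_algebraMap_of_star_eq σ hst (u : v.adicCompletionIntegers K))
    (algebraMap_unit_ne_zero (F := v.adicCompletion K) u) (isInteger_algebraMap (u : v.adicCompletionIntegers K))
    (isInteger_algebraMap_unit_inv u)
    (irreducible_uniformiser (map_maximalIdeal_integralClosure_eq_of_irreducible v w hϖ hinert) hϖ)
    (star_algebraMap_of_star_eq σ hst ϖ) k (exists_trace_lift_adicCompletion v w σ hst he h2 hσ hϖ hinert)
    (exists_residueStar_ne_adicCompletion v w σ hst he h2 hσ hϖ hinert) hα _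
    (by rw [card_traceZero_eq_absNorm v w σ hst he h2 hσ hϖ hinert]) _
    (by rw [card_traceZero_eq_absNorm v w σ hst he h2 hσ hϖ hinert]) χ hχ

include hst he h2 hσ hϖ hinert in
/-- **EVERY `K`-SPHERICAL IRREDUCIBLE REPRESENTATION OF `U(J₃(u))(L_w)` IS A SPHERICAL SUBQUOTIENT OF AN
UNRAMIFIED PRINCIPAL SERIES `I(α N(v)⁻²)`**: for every `λ` and every `χ` with `χ(T₁) = λ` there is `α ≠ 0` with
`λ = N(v)²(α + α⁻¹) + (N(v) − 1)` and `π_χ ≅ inertSphericalQuot (α N(v)⁻²)`. -/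
theorem exists_param_nonempty_equiv_inertSphericalQuot_quotRep_adicCompletion (lam : k)
    (χ : heckeAlgebra k (hyperspecialSubgroup (integralClosure (v.adicCompletionIntegers K) (w.adicCompletion L))
      (J3 (algebraMap (v.adicCompletionIntegers K) (w.adicCompletion L) (u : v.adicCompletionIntegers K)))) →ₐ[k] k)
    (hχ : χ (heckeBasisCells (hstar_of_star_eq σ hst)
        (algebraMap (v.adicCompletionIntegers K) (w.adicCompletion L) (u : v.adicCompletionIntegers K))
        (star_algebraMap_of_star_eq σ hst (u : v.adicCompletionIntegers K))
        (algebraMap_unit_ne_zero (F := v.adicCompletion K) u) (isInteger_algebraMap (u : v.adicCompletionIntegers K))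
        (isInteger_algebraMap_unit_inv u)
        (irreducible_uniformiser (map_maximalIdeal_integralClosure_eq_of_irreducible v w hϖ hinert) hϖ)
        (star_algebraMap_of_star_eq σ hst ϖ) k 1) = lam) :
    ∃ α : k, α ≠ 0 ∧
      lam = (Ideal.absNorm v.asIdeal : k) ^ 2 * (α + α⁻¹) + ((Ideal.absNorm v.asIdeal : k) - 1) ∧
      letI := charModule k
        (hyperspecialSubgroup (integralClosure (v.adicCompletionIntegers K) (w.adicCompletion L))
          (J3 (algebraMap (v.adicCompletionIntegers K) (w.adicCompletion L) (u : v.adicCompletionIntegers K)))) χ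
      letI := charScalarTower k
        (hyperspecialSubgroup (integralClosure (v.adicCompletionIntegers K) (w.adicCompletion L))
          (J3 (algebraMap (v.adicCompletionIntegers K) (w.adicCompletion L) (u : v.adicCompletionIntegers K)))) χ
      Nonempty ((inertSphericalQuot (hstar_of_star_eq σ hst)
        (algebraMap (v.adicCompletionIntegers K) (w.adicCompletion L) (u : v.adicCompletionIntegers K))
        (star_algebraMap_of_star_eq σ hst (u : v.adicCompletionIntegers K))
        (algebraMap_unit_ne_zero (F := v.adicCompletion K) u) (isInteger_algebraMap (u : v.adicCompletionIntegers K))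
        (isInteger_algebraMap_unit_inv u)
        (irreducible_uniformiser (map_maximalIdeal_integralClosure_eq_of_irreducible v w hϖ hinert) hϖ)
        (star_algebraMap_of_star_eq σ hst ϖ) k (α * ((Ideal.absNorm v.asIdeal : k) ^ 2)⁻¹)).Equiv
          (quotRep k (hyperspecialSubgroup (integralClosure (v.adicCompletionIntegers K) (w.adicCompletion L))
            (J3 (algebraMap (v.adicCompletionIntegers K) (w.adicCompletion L) (u : v.adicCompletionIntegers K)))) k
            (fun _ => inferInstance))) := by
  obtain ⟨α, hα, hlam⟩ := exists_param_eq ((Ideal.absNorm v.asIdeal : ℕ) : k)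
    (absNorm_natCast_ne_zero v k) lam
  refine ⟨α, hα, hlam, ?_⟩
  exact nonempty_equiv_inertSphericalQuot_quotRep_of_eq (hstar_of_star_eq σ hst)
    (algebraMap (v.adicCompletionIntegers K) (w.adicCompletion L) (u : v.adicCompletionIntegers K))
    (star_algebraMap_of_star_eq σ hst (u : v.adicCompletionIntegers K))
    (algebraMap_unit_ne_zero (F := v.adicCompletion K) u) (isInteger_algebraMap (u : v.adicCompletionIntegers K))
    (isInteger_algebraMap_unit_inv u)
    (irreducible_uniformiser (map_maximalIdeal_integralClosure_eq_of_irreducible v w hϖ hinert) hϖ)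
    (star_algebraMap_of_star_eq σ hst ϖ) k (exists_trace_lift_adicCompletion v w σ hst he h2 hσ hϖ hinert)
    (exists_residueStar_ne_adicCompletion v w σ hst he h2 hσ hϖ hinert) hα _
    (by rw [card_traceZero_eq_absNorm v w σ hst he h2 hσ hϖ hinert]) _
    (by rw [card_traceZero_eq_absNorm v w σ hst he h2 hσ hϖ hinert]) χ (hχ.trans hlam)

end Completion

section Toy

open Summit.Ventures.HodgeRepro2.T5GaussianField Summit.Ventures.HodgeRepro2.T5EisensteinField
  Summit.Ventures.HodgeRepro2.T5EisensteinInertPlace Summit.Ventures.HodgeRepro2.T5GaussianPlace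
  Summit.Ventures.HodgeRepro2.T5InertDegreeToy

variable (w : HeightOneSpectrum (RingOfIntegers L₃)) [w.asIdeal.LiesOver v₂.asIdeal]
  [IsDiscreteValuationRing (integralClosure (v₂.adicCompletionIntegers ℚ) (w.adicCompletion L₃))]
  [Finite (IsLocalRing.ResidueField (integralClosure (v₂.adicCompletionIntegers ℚ) (w.adicCompletion L₃)))]
  [IsFractionRing (integralClosure (v₂.adicCompletionIntegers ℚ) (w.adicCompletion L₃)) (w.adicCompletion L₃)]
  [StarRing (w.adicCompletion L₃)]
  (σ : (w.adicCompletion L₃) ≃ₐ[v₂.adicCompletion ℚ] (w.adicCompletion L₃))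
  (hst : ∀ x : w.adicCompletion L₃, star x = σ x) (hσ : σ ≠ 1)
  (u : (v₂.adicCompletionIntegers ℚ)ˣ) (k : Type*) [Field k] [CharZero k] [IsAlgClosed k]

include hst hσ in
/-- **THE NUMERAL: at the place `2` of `ℚ(ζ₃)`** (`N(v) = 2`), `χ(T₁) = 4(α + α⁻¹) + 1` gives
`π_χ ≅ inertSphericalQuot (α / 4)`. -/
theorem nonempty_equiv_inertSphericalQuot_quotRep_toy {α : k} (hα : α ≠ 0)
    (χ : heckeAlgebra k (hyperspecialSubgroup (integralClosure (v₂.adicCompletionIntegers ℚ) (w.adicCompletion L₃))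
      (J3 (algebraMap (v₂.adicCompletionIntegers ℚ) (w.adicCompletion L₃) (u : v₂.adicCompletionIntegers ℚ)))) →ₐ[k] k)
    (hχ : χ (heckeBasisCells (hstar_of_star_eq σ hst)
        (algebraMap (v₂.adicCompletionIntegers ℚ) (w.adicCompletion L₃) (u : v₂.adicCompletionIntegers ℚ))
        (star_algebraMap_of_star_eq σ hst (u : v₂.adicCompletionIntegers ℚ))
        (algebraMap_unit_ne_zero (F := v₂.adicCompletion ℚ) u)
        (isInteger_algebraMap (u : v₂.adicCompletionIntegers ℚ)) (isInteger_algebraMap_unit_inv u)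
        (irreducible_uniformiser (map_maximalIdeal_integralClosure_eq_of_irreducible v₂ w irreducible_two
          (irreducible_algebraMap_two w)) irreducible_two)
        (star_algebraMap_of_star_eq σ hst (2 : v₂.adicCompletionIntegers ℚ)) k 1) = 4 * (α + α⁻¹) + 1) :
    letI := charModule k
      (hyperspecialSubgroup (integralClosure (v₂.adicCompletionIntegers ℚ) (w.adicCompletion L₃))
        (J3 (algebraMap (v₂.adicCompletionIntegers ℚ) (w.adicCompletion L₃) (u : v₂.adicCompletionIntegers ℚ)))) χ
    letI := charScalarTower k
      (hyperspecialSubgroup (integralClosure (v₂.adicCompletionIntegers ℚ) (w.adicCompletion L₃))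
        (J3 (algebraMap (v₂.adicCompletionIntegers ℚ) (w.adicCompletion L₃) (u : v₂.adicCompletionIntegers ℚ)))) χ
    Nonempty ((inertSphericalQuot (hstar_of_star_eq σ hst)
      (algebraMap (v₂.adicCompletionIntegers ℚ) (w.adicCompletion L₃) (u : v₂.adicCompletionIntegers ℚ))
      (star_algebraMap_of_star_eq σ hst (u : v₂.adicCompletionIntegers ℚ))
      (algebraMap_unit_ne_zero (F := v₂.adicCompletion ℚ) u)
      (isInteger_algebraMap (u : v₂.adicCompletionIntegers ℚ)) (isInteger_algebraMap_unit_inv u)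
      (irreducible_uniformiser (map_maximalIdeal_integralClosure_eq_of_irreducible v₂ w irreducible_two
        (irreducible_algebraMap_two w)) irreducible_two)
      (star_algebraMap_of_star_eq σ hst (2 : v₂.adicCompletionIntegers ℚ)) k (α * (4 : k)⁻¹)).Equiv
        (quotRep k (hyperspecialSubgroup (integralClosure (v₂.adicCompletionIntegers ℚ) (w.adicCompletion L₃))
          (J3 (algebraMap (v₂.adicCompletionIntegers ℚ) (w.adicCompletion L₃) (u : v₂.adicCompletionIntegers ℚ)))) k
          (fun _ => inferInstance))) := by
  have hq := card_traceZero_eq_absNorm v₂ w σ hst (ramificationIdx'_eq_one w) (finrank_eq_two w) hσ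
    irreducible_two (irreducible_algebraMap_two w)
  exact nonempty_equiv_inertSphericalQuot_quotRep_of_eq (hstar_of_star_eq σ hst)
    (algebraMap (v₂.adicCompletionIntegers ℚ) (w.adicCompletion L₃) (u : v₂.adicCompletionIntegers ℚ))
    (star_algebraMap_of_star_eq σ hst (u : v₂.adicCompletionIntegers ℚ))
    (algebraMap_unit_ne_zero (F := v₂.adicCompletion ℚ) u)
    (isInteger_algebraMap (u : v₂.adicCompletionIntegers ℚ)) (isInteger_algebraMap_unit_inv u)
    (irreducible_uniformiser (map_maximalIdeal_integralClosure_eq_of_irreducible v₂ w irreducible_two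
      (irreducible_algebraMap_two w)) irreducible_two)
    (star_algebraMap_of_star_eq σ hst (2 : v₂.adicCompletionIntegers ℚ)) k
    (exists_trace_lift_adicCompletion v₂ w σ hst (ramificationIdx'_eq_one w) (finrank_eq_two w) hσ
      irreducible_two (irreducible_algebraMap_two w))
    (exists_residueStar_ne_adicCompletion v₂ w σ hst (ramificationIdx'_eq_one w) (finrank_eq_two w) hσ
      irreducible_two (irreducible_algebraMap_two w)) hα _
    (by rw [hq, absNorm_v₂]; norm_num) _ (by rw [hq, absNorm_v₂]; norm_num) χ hχ

end Toy

end Summit.Ventures.HodgeRepro2.T5InertSphericalSubquotientCompletion
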